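import Summits.QuantumAdvantage.QuantumAdvantage.Theses.ParityFrontier
import Literature.Computability.Complexity.BPExpOperator
import Literature.Computability.Complexity.TodaPartOne
import Literature.Computability.Complexity.TodaPartTwo
import Literature.Computability.Complexity.SipserGacsLautemann
import Literature.Computability.Complexity.NPClosureProofs
import Literature.Computability.Complexity.OracleEmpty
import Literature.Computability.Complexity.CircuitClasses
import Literature.Computability.Complexity.Promise
import Literature.Computability.QuantumComplexity.BQPSubsetPP
import Literature.Computability.QuantumComplexity.BQPSubsetAWPP
import Literature.Computability.QuantumComplexity.CountingSimulationProofs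
import Literature.Computability.QuantumComplexity.OracleSeparationsProofs
import Literature.Computability.Cryptography.ClassBQPRelProofs
import Literature.Barriers.QuantumAdvantage.Catalogue

/-!
# BC2 probes for crux `ParityFrontier.Target` (stmt-QuantumAdvantage-1952) — companion of STRATEGY-CENSUS.md §D.0

The instruction's cheap probe `first | exact? | simpa [piece] | (unfold piece; simpa) | aesop` (aesop terminal),
run on the implications `piece → S`, `piece → X` for every piece of the candidate decompositions D3a–D7, plus
calibration/converse probes. SELF-CERTIFYING FORM (as in the sibling `PneNP/Cruxes/CircuitThesis/Probes.lean`):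
each probe ends in `| sorry`, so the file elaborates and the number of `declaration uses 'sorry'` warnings equals
the number of probes whose search tactics all FAILED. Imports are GENEROUS (the route file, Toda I/II,
Sipser–Gács–Lautemann, `BQP ⊆ PP/AWPP`, the empty-oracle bridges, the whole barrier catalogue), so that any
one-step landed implication would be found. Pieces are re-declared here verbatim from `StrategyCensus.lean`
(namespace `…Target.Probes`) so that no census THEOREM is in scope — only defs and landed modules.

RESULT (farm, 2026-08-17, wall 136 s): rc 0, 29 `example`s, 28 sorries. The calibration probe C1 `X → S`
SUCCEEDS (`exact?` finds `exact fun a => Theses.ParityFrontier.closes a` — so one-step landed implications ARE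
seen); C2 `S → X`, C3 `X → RelFrontier` and all 26 piece probes (13 pieces × {→ S, → X}) FAIL. By name, one piece
nevertheless gives `S` on its own: `BQPNotPH → S` (two landed steps, `StrategyCensus.summit_of_BQPNotPH`); probe
failure is necessary for criterion (c), not sufficient.
-/

set_option maxHeartbeats 400000
set_option linter.unusedVariables false
set_option linter.dupNamespace false
set_option linter.unusedTactic false
set_option linter.unreachableTactic false

namespace Summit.QuantumAdvantage.QuantumAdvantage.Cruxes.Target.Probes

open Literature.Computability.Complexity Literature.Computability.Cryptography
open Literature.Computability.QuantumComplexity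
open Summit.QuantumAdvantage.QuantumAdvantage.Theses.ParityFrontier (Target RelFrontier)

abbrev X : Prop := Target
abbrev S : Prop := _root_.QuantumAdvantage

def DerandBPParity : Prop := bp ParityP ⊆ ParityP
def BQPNotParityP : Prop := ¬ (BQP ⊆ ParityP)
def BPParitySubsetParityPoly : Prop := bp ParityP ⊆ polyAdvice ParityP
def BQPNotParityPoly : Prop := ¬ (BQP ⊆ polyAdvice ParityP)
def RelTransfer : Prop := RelFrontier → X
def PromiseBPParity' : Set PromiseProblem :=
  {Q | ∃ L' ∈ ParityP, ∃ p : Polynomial ℕ,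
    (∀ x ∈ Q.yes, 2 / 3 ≤ uniformProb (p.eval x.length) {y : List Bool | boolPair x y ∈ L'}) ∧
    (∀ x ∈ Q.no, 2 / 3 ≤ uniformProb (p.eval x.length) {y : List Bool | boolPair x y ∉ L'})}
def PromiseTarget : Prop := ¬ (PromiseBQP ⊆ PromiseBPParity')
def ParityPromiseLift : Prop := BQP ⊆ bp ParityP → PromiseBQP ⊆ PromiseBPParity'
def PPNotBPParity : Prop := ¬ (PP ⊆ bp ParityP)
def PPBridge : Prop := PPNotBPParity → X
def BQPNotPH : Prop := ¬ (BQP ⊆ PH)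
def PHNotBPP : Prop := ¬ (PH ⊆ BPP)
def CollapseBridge : Prop := BQP ⊆ bp ParityP → PH ⊆ BPP

-- calibration C1: X → S (EXPECTED TO SUCCEED: `closes` is a landed one-step implication)
example : X → S := by
  first | exact? | simpa | (aesop (config := { terminal := true, warnOnNonterminal := false })) | sorry
-- calibration C2: S → X (expected to fail: X is strictly above S)
example : S → X := by
  first | exact? | simpa | (aesop (config := { terminal := true, warnOnNonterminal := false })) | sorry
-- calibration C3: X → RelFrontier (two landed rewrites away; by name: StrategyCensus.relFrontier_of_X)
example : X → RelFrontier := by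
  first | exact? | simpa [RelFrontier] | (aesop (config := { terminal := true, warnOnNonterminal := false })) | sorry

-- D3a / P1: DerandBPParity
example : DerandBPParity → S := by
  first | exact? | simpa [DerandBPParity] | (unfold DerandBPParity; simpa) | (aesop (config := { terminal := true, warnOnNonterminal := false })) | sorry
example : DerandBPParity → X := by
  first | exact? | simpa [DerandBPParity] | (unfold DerandBPParity; simpa) | (aesop (config := { terminal := true, warnOnNonterminal := false })) | sorry
-- D3a / P2: BQPNotParityP
example : BQPNotParityP → S := by
  first | exact? | simpa [BQPNotParityP] | (unfold BQPNotParityP; simpa) | (aesop (config := { terminal := true, warnOnNonterminal := false })) | sorry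
example : BQPNotParityP → X := by
  first | exact? | simpa [BQPNotParityP] | (unfold BQPNotParityP; simpa) | (aesop (config := { terminal := true, warnOnNonterminal := false })) | sorry
-- D3b / P3: BPParitySubsetParityPoly
example : BPParitySubsetParityPoly → S := by
  first | exact? | simpa [BPParitySubsetParityPoly] | (unfold BPParitySubsetParityPoly; simpa) | (aesop (config := { terminal := true, warnOnNonterminal := false })) | sorry
example : BPParitySubsetParityPoly → X := by
  first | exact? | simpa [BPParitySubsetParityPoly] | (unfold BPParitySubsetParityPoly; simpa) | (aesop (config := { terminal := true, warnOnNonterminal := false })) | sorry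
-- D3b / P4: BQPNotParityPoly
example : BQPNotParityPoly → S := by
  first | exact? | simpa [BQPNotParityPoly] | (unfold BQPNotParityPoly; simpa) | (aesop (config := { terminal := true, warnOnNonterminal := false })) | sorry
example : BQPNotParityPoly → X := by
  first | exact? | simpa [BQPNotParityPoly] | (unfold BQPNotParityPoly; simpa) | (aesop (config := { terminal := true, warnOnNonterminal := false })) | sorry
-- D4 / P5: RelFrontier (route crux 1954)
example : RelFrontier → S := by
  first | exact? | simpa [RelFrontier] | (unfold RelFrontier; simpa) | (aesop (config := { terminal := true, warnOnNonterminal := false })) | sorry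
example : RelFrontier → X := by
  first | exact? | simpa [RelFrontier] | (unfold RelFrontier; simpa) | (aesop (config := { terminal := true, warnOnNonterminal := false })) | sorry
-- D4 / P6: RelTransfer
example : RelTransfer → S := by
  first | exact? | simpa [RelTransfer] | (unfold RelTransfer; simpa) | (aesop (config := { terminal := true, warnOnNonterminal := false })) | sorry
example : RelTransfer → X := by
  first | exact? | simpa [RelTransfer] | (unfold RelTransfer; simpa) | (aesop (config := { terminal := true, warnOnNonterminal := false })) | sorry
-- D5 / P7: PromiseTarget
example : PromiseTarget → S := by
  first | exact? | simpa [PromiseTarget] | (unfold PromiseTarget; simpa) | (aesop (config := { terminal := true, warnOnNonterminal := false })) | sorry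
example : PromiseTarget → X := by
  first | exact? | simpa [PromiseTarget] | (unfold PromiseTarget; simpa) | (aesop (config := { terminal := true, warnOnNonterminal := false })) | sorry
-- D5 / P8: ParityPromiseLift
example : ParityPromiseLift → S := by
  first | exact? | simpa [ParityPromiseLift] | (unfold ParityPromiseLift; simpa) | (aesop (config := { terminal := true, warnOnNonterminal := false })) | sorry
example : ParityPromiseLift → X := by
  first | exact? | simpa [ParityPromiseLift] | (unfold ParityPromiseLift; simpa) | (aesop (config := { terminal := true, warnOnNonterminal := false })) | sorry
-- D6 / P9: PPNotBPParity
example : PPNotBPParity → S := by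
  first | exact? | simpa [PPNotBPParity] | (unfold PPNotBPParity; simpa) | (aesop (config := { terminal := true, warnOnNonterminal := false })) | sorry
example : PPNotBPParity → X := by
  first | exact? | simpa [PPNotBPParity] | (unfold PPNotBPParity; simpa) | (aesop (config := { terminal := true, warnOnNonterminal := false })) | sorry
-- D6 / P10: PPBridge
example : PPBridge → S := by
  first | exact? | simpa [PPBridge] | (unfold PPBridge; simpa) | (aesop (config := { terminal := true, warnOnNonterminal := false })) | sorry
example : PPBridge → X := by
  first | exact? | simpa [PPBridge] | (unfold PPBridge; simpa) | (aesop (config := { terminal := true, warnOnNonterminal := false })) | sorry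
-- D6 / P11: BQPNotPH (by name it GIVES S: StrategyCensus.summit_of_BQPNotPH, two landed steps)
example : BQPNotPH → S := by
  first | exact? | simpa [BQPNotPH] | (unfold BQPNotPH; simpa) | (aesop (config := { terminal := true, warnOnNonterminal := false })) | sorry
example : BQPNotPH → X := by
  first | exact? | simpa [BQPNotPH] | (unfold BQPNotPH; simpa) | (aesop (config := { terminal := true, warnOnNonterminal := false })) | sorry
-- D7 / P12: PHNotBPP
example : PHNotBPP → S := by
  first | exact? | simpa [PHNotBPP] | (unfold PHNotBPP; simpa) | (aesop (config := { terminal := true, warnOnNonterminal := false })) | sorry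
example : PHNotBPP → X := by
  first | exact? | simpa [PHNotBPP] | (unfold PHNotBPP; simpa) | (aesop (config := { terminal := true, warnOnNonterminal := false })) | sorry
-- D7 / P13: CollapseBridge
example : CollapseBridge → S := by
  first | exact? | simpa [CollapseBridge] | (unfold CollapseBridge; simpa) | (aesop (config := { terminal := true, warnOnNonterminal := false })) | sorry
example : CollapseBridge → X := by
  first | exact? | simpa [CollapseBridge] | (unfold CollapseBridge; simpa) | (aesop (config := { terminal := true, warnOnNonterminal := false })) | sorry

end Summit.QuantumAdvantage.QuantumAdvantage.Cruxes.Target.Probes
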